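import Mathlib
import Summits.CriticalPhenomena.Ising3DConformalLimit.Theorems.PlantedPinningPinningEfficiencyLeOneCondExp
import Summits.CriticalPhenomena.Ising3DConformalLimit.Theorems.PlantedPinningPinningEfficiencyLeOneCounting

/-!
# The pinning lemma for a finite `±1` spin system (pinning-lemma toolkit, III)

Route `PlantedPinning` of `Ising3DConformalLimit`, support item stmt-CriticalPhenomena-8455
(`PinningEfficiencyLeOne`).  Abstract form of the pinning lemma (Montanari 2008, arXiv:0709.0145;
Raghavendra–Tan, SODA 2012, Lemma 4.3; El Alaoui–Montanari 2021, eqs. (1.4)–(1.6)):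
for a finite type `Ω` of patterns with strictly positive probability weights `w`, spins
`s x : Ω → ℝ` with `s x ω ∈ {±1}` indexed by the sites of a finite set `Λ` (`|Λ| = n`), total spin
`M = ∑_{x ∈ Λ} s x`, and the conditional expectations `E P` given the spins on `P ⊆ Λ`
(class kernels `K P a b = 1 ⟺ s|_P a = s|_P b`), the average over `k`-subsets `P` of the
expected conditional variance `v(P) = 𝔼_w Var(M | s|_P)` satisfies
`k · (∑_{|P| = k} v(P)) / (n choose k) ≤ (n + 1)(n − k + 1)` (`pinning_lemma`).
Proof: one more uniformly random pin lowers `v` by at least `v²/(n−j)²` on average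
(`one_step`: one-pin variance drop, Cauchy–Schwarz over the new pin, Jensen over patterns and pin
sets), and the resulting Riccati inequality integrates to the bound (`riccati_bound`).
No definitions: kernels and conditional expectations enter through their defining equations.
-/

namespace Summit.CriticalPhenomena.Ising3DConformalLimit.PlantedPinningCeiling

open Finset

variable {V Ω : Type*} [DecidableEq V] [Fintype Ω]

section Spins

variable (w : Ω → ℝ) (s : V → Ω → ℝ) (Λ : Finset V)
  {K : Finset V → Ω → Ω → ℝ} {E : Finset V → (Ω → ℝ) → Ω → ℝ}
  (hK1 : ∀ P a b, (∀ x ∈ P, s x a = s x b) → K P a b = 1)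
  (hK0 : ∀ P a b, ¬ (∀ x ∈ P, s x a = s x b) → K P a b = 0)
  (hE : ∀ P f ω, E P f ω = (∑ ω', K P ω ω' * w ω' * f ω') / ∑ ω', K P ω ω' * w ω')

omit [DecidableEq V] [Fintype Ω] in
include hK1 hK0 in
/-- The agreement kernels are `0/1`-valued, reflexive, symmetric and transitive, and
`K P a b = 1` iff the spins on `P` agree. [folklore] -/
theorem agreeKernel_props (P : Finset V) :
    (∀ a b, K P a b = 1 ↔ ∀ x ∈ P, s x a = s x b) ∧ (∀ a b, K P a b = 0 ∨ K P a b = 1) ∧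
    (∀ a, K P a a = 1) ∧ (∀ a b, K P a b = K P b a) ∧
    (∀ a b c, K P a b = 1 → K P b c = 1 → K P a c = 1) := by
  have hiff : ∀ a b, K P a b = 1 ↔ ∀ x ∈ P, s x a = s x b := fun a b =>
    ⟨fun h => by
      by_contra hn
      rw [hK0 P a b hn] at h
      exact zero_ne_one h, hK1 P a b⟩
  refine ⟨hiff, fun a b => ?_, fun a => hK1 P a a (fun x _ => rfl), fun a b => ?_, fun a b c hab hbc => ?_⟩
  · by_cases h : ∀ x ∈ P, s x a = s x b
    · exact Or.inr (hK1 P a b h)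
    · exact Or.inl (hK0 P a b h)
  · by_cases h : ∀ x ∈ P, s x a = s x b
    · rw [hK1 P a b h, hK1 P b a (fun x hx => (h x hx).symm)]
    · rw [hK0 P a b h, hK0 P b a (fun h' => h (fun x hx => (h' x hx).symm))]
  · exact hK1 P a c fun x hx => ((hiff a b).1 hab x hx).trans ((hiff b c).1 hbc x hx)

include hK1 hK0 hE in
/-- **Sum of the one-pin conditional covariances**: for `P ⊆ Λ`,
`∑_{z ∈ Λ ∖ P} Cov(M, s z | s|_P) = Var(M | s|_P)` (the pinned spins have zero conditional
covariance). [folklore] -/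
theorem sum_condCov_eq_condVar (hw : ∀ ω, 0 < w ω) {P : Finset V} (hP : P ⊆ Λ)
    {M : Ω → ℝ} (hM : ∀ ω, M ω = ∑ x ∈ Λ, s x ω) (ω : Ω) :
    ∑ z ∈ Λ \ P, (E P (fun ω => M ω * s z ω) ω - E P M ω * E P (s z) ω) =
      E P (fun ω => M ω ^ 2) ω - (E P M ω) ^ 2 := by
  obtain ⟨hiff, h01, hrefl, hsymm, htrans⟩ := agreeKernel_props s hK1 hK0 P
  have hZ : ∀ ω, ∑ ω', K P ω ω' * w ω' ≠ 0 := fun ω => (ksum_one_pos w (K P) hw h01 hrefl ω).ne'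
  -- the pinned part `S = ∑_{x ∈ P} s x` is `K P`-invariant
  set S : Ω → ℝ := fun ω => ∑ x ∈ P, s x ω with hSdef
  have hSinv : ∀ a b, K P a b = 1 → S a = S b := fun a b hab =>
    Finset.sum_congr rfl fun x hx => (hiff a b).1 hab x hx
  have hsumT : ∀ ω, ∑ z ∈ Λ \ P, s z ω = M ω - S ω := fun ω => by
    rw [hM ω, hSdef, eq_sub_iff_add_eq, Finset.sum_sdiff hP]
  -- first sum: `∑_z E(M s_z) = E(M (M - S)) = E(M²) - E M · S`
  have h1 : ∑ z ∈ Λ \ P, E P (fun ω => M ω * s z ω) ω = E P (fun ω => M ω ^ 2) ω - E P M ω * S ω := by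
    have hfs := cexp_finset_sum w (K P) (hE P) (Λ \ P) (fun z ω => M ω * s z ω) ω
    have hfun : (fun ω => ∑ z ∈ Λ \ P, M ω * s z ω) = fun ω => M ω ^ 2 - M ω * S ω := by
      funext ω'
      rw [← Finset.mul_sum, hsumT ω']
      ring
    rw [← hfs, hfun, cexp_sub w (K P) (hE P), cexp_mul_of_invariant w (K P) (hE P) h01 hSinv M ω]
  -- second sum: `∑_z E M · E s_z = E M · (E M - S)`
  have h2 : ∑ z ∈ Λ \ P, E P M ω * E P (s z) ω = E P M ω * (E P M ω - S ω) := by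
    rw [← Finset.mul_sum]
    congr 1
    have hfs := cexp_finset_sum w (K P) (hE P) (Λ \ P) s ω
    have hfun : (fun ω => ∑ z ∈ Λ \ P, s z ω) = fun ω => M ω - S ω := funext hsumT
    rw [← hfs, hfun, cexp_sub w (K P) (hE P), cexp_of_invariant w (K P) (hE P) hZ h01 hSinv ω]
  rw [Finset.sum_sub_distrib, h1, h2]
  ring

include hK1 hK0 hE in
/-- **One step of the pinning lemma**: for `P ⊆ Λ` with `Λ ∖ P ≠ ∅`, writing
`v(Q) = 𝔼_w Var(M | s|_Q)`,  `v(P)² / |Λ ∖ P| ≤ ∑_{z ∈ Λ ∖ P} (v(P) − v(P ∪ {z}))`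
(one-pin variance drop, Cauchy–Schwarz over `z`, Jensen over `ω`;
Raghavendra–Tan 2012, Lemma 4.3). [folklore] -/
theorem one_step (hw : ∀ ω, 0 < w ω) (hw1 : ∑ ω, w ω = 1) (hs : ∀ x ω, s x ω ^ 2 = 1)
    {P : Finset V} (hP : P ⊆ Λ) (hne : (Λ \ P).Nonempty)
    {M : Ω → ℝ} (hM : ∀ ω, M ω = ∑ x ∈ Λ, s x ω) :
    (∑ ω, w ω * (E P (fun ω => M ω ^ 2) ω - (E P M ω) ^ 2)) ^ 2 / #(Λ \ P) ≤
      ∑ z ∈ Λ \ P, (∑ ω, w ω * (E P (fun ω => M ω ^ 2) ω - (E P M ω) ^ 2) -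
        ∑ ω, w ω * (E (insert z P) (fun ω => M ω ^ 2) ω - (E (insert z P) M ω) ^ 2)) := by
  obtain ⟨hiff, h01, hrefl, hsymm, htrans⟩ := agreeKernel_props s hK1 hK0 P
  -- conditional covariances `C z ω = Cov(M, s z | s|_P)(ω)` and variance `X ω = Var(M | s|_P)(ω)`
  set C : V → Ω → ℝ := fun z ω => E P (fun ω => M ω * s z ω) ω - E P M ω * E P (s z) ω with hC
  set X : Ω → ℝ := fun ω => E P (fun ω => M ω ^ 2) ω - (E P M ω) ^ 2 with hX
  have hm : (0 : ℝ) < #(Λ \ P) := by exact_mod_cast hne.card_pos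
  -- (1) one-pin variance drop for each new pin `z`
  have hdrop : ∀ z ∈ Λ \ P, ∑ ω, w ω * (C z ω) ^ 2 ≤
      ∑ ω, w ω * (E P (fun ω => M ω ^ 2) ω - (E P M ω) ^ 2) -
        ∑ ω, w ω * (E (insert z P) (fun ω => M ω ^ 2) ω - (E (insert z P) M ω) ^ 2) := by
    intro z _
    obtain ⟨hiff', h01', hrefl', hsymm', htrans'⟩ := agreeKernel_props s hK1 hK0 (insert z P)
    have href : ∀ a b, K (insert z P) a b = 1 → K P a b = 1 := fun a b hab =>
      hK1 P a b fun x hx => (hiff' a b).1 hab x (Finset.mem_insert_of_mem hx)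
    have hsinv : ∀ a b, K (insert z P) a b = 1 → s z a = s z b := fun a b hab =>
      (hiff' a b).1 hab z (Finset.mem_insert_self z P)
    exact sum_condCov_sq_le_vbar_sub w (K P) (K (insert z P)) (hE P) (hE (insert z P)) hw
      h01 hrefl hsymm htrans h01' hrefl' hsymm' htrans' href M (s z) (hs z) hsinv
  -- (2) Cauchy–Schwarz over `z`, pointwise in `ω`, with `∑_z C z ω = X ω`
  have hcs : ∀ ω, (X ω) ^ 2 / #(Λ \ P) ≤ ∑ z ∈ Λ \ P, (C z ω) ^ 2 := by
    intro ω
    have hsumC : ∑ z ∈ Λ \ P, C z ω = X ω := sum_condCov_eq_condVar w s Λ hK1 hK0 hE hw hP hM ω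
    rw [div_le_iff₀ hm, ← hsumC]
    have := sq_sum_le_card_mul_sum_sq (s := Λ \ P) (f := fun z => C z ω)
    linarith
  -- (3) Jensen over `ω`
  have hjensen : (∑ ω, w ω * X ω) ^ 2 ≤ ∑ ω, w ω * (X ω) ^ 2 :=
    sq_wsum_le_wsum_sq (fun ω => (hw ω).le) hw1 X
  -- combine
  calc (∑ ω, w ω * X ω) ^ 2 / #(Λ \ P)
      ≤ (∑ ω, w ω * (X ω) ^ 2) / #(Λ \ P) := div_le_div_of_nonneg_right hjensen hm.le
    _ = ∑ ω, w ω * ((X ω) ^ 2 / #(Λ \ P)) := by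
        rw [Finset.sum_div]
        exact Finset.sum_congr rfl fun ω _ => by ring
    _ ≤ ∑ ω, w ω * ∑ z ∈ Λ \ P, (C z ω) ^ 2 :=
        Finset.sum_le_sum fun ω _ => mul_le_mul_of_nonneg_left (hcs ω) (hw ω).le
    _ = ∑ z ∈ Λ \ P, ∑ ω, w ω * (C z ω) ^ 2 := by
        rw [Finset.sum_comm]
        exact Finset.sum_congr rfl fun ω _ => by rw [Finset.mul_sum]
    _ ≤ _ := Finset.sum_le_sum hdrop

include hK1 hK0 hE in
/-- **The pinning lemma** (Montanari 2008; Raghavendra–Tan 2012, Lemma 4.3; El Alaoui–Montanari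
2021, (1.4)–(1.6)), abstract finite form: with `v(P) = 𝔼_w Var(M | s|_P)` the expected
conditional variance of the total spin given the spins on `P`, for `1 ≤ k ≤ n = |Λ|`,
`k · (∑_{P ⊆ Λ, |P| = k} v(P)) / (n choose k) ≤ (n + 1) · (n − k + 1)`. [folklore] -/
theorem pinning_lemma (hw : ∀ ω, 0 < w ω) (hw1 : ∑ ω, w ω = 1) (hs : ∀ x ω, s x ω ^ 2 = 1)
    {M : Ω → ℝ} (hM : ∀ ω, M ω = ∑ x ∈ Λ, s x ω) {k : ℕ} (hkn : k ≤ #Λ) :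
    (k : ℝ) * ((∑ P ∈ Λ.powersetCard k,
        ∑ ω, w ω * (E P (fun ω => M ω ^ 2) ω - (E P M ω) ^ 2)) / ((#Λ).choose k : ℝ)) ≤
      ((#Λ : ℝ) + 1) * ((#Λ : ℝ) - k + 1) := by
  set n := #Λ with hn
  -- `vb Q = 𝔼 Var(M | s|_Q)`, `A j = ∑_{|P| = j} vb P`, `v j = A j / (n choose j)`
  set vb : Finset V → ℝ := fun Q => ∑ ω, w ω * (E Q (fun ω => M ω ^ 2) ω - (E Q M ω) ^ 2)
    with hvb
  set v : ℕ → ℝ := fun j => (∑ P ∈ Λ.powersetCard j, vb P) / (n.choose j : ℝ) with hv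
  have hvb0 : ∀ Q, 0 ≤ vb Q := fun Q => by
    obtain ⟨_, h01, hrefl, _, _⟩ := agreeKernel_props s hK1 hK0 Q
    exact vbar_nonneg w (K Q) (hE Q) hw h01 hrefl M
  have h0 : ∀ j, 0 ≤ v j := fun j =>
    div_nonneg (Finset.sum_nonneg fun Q _ => hvb0 Q) (Nat.cast_nonneg _)
  have hstepv : ∀ j, j < n → v (j + 1) ≤ v j - (v j) ^ 2 / ((n : ℝ) - j) ^ 2 := by
    intro j hj
    set A := ∑ P ∈ Λ.powersetCard j, vb P with hA
    set A' := ∑ Q ∈ Λ.powersetCard (j + 1), vb Q with hA'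
    set Cj : ℝ := (n.choose j : ℝ) with hCj
    set Cj' : ℝ := (n.choose (j + 1) : ℝ) with hCj'
    set m : ℝ := (n : ℝ) - j with hm
    have hCpos : 0 < Cj := by rw [hCj]; exact_mod_cast Nat.choose_pos hj.le
    have hC'pos : 0 < Cj' := by rw [hCj']; exact_mod_cast Nat.choose_pos hj
    have hmpos : 0 < m := by
      have : (j : ℝ) + 1 ≤ n := by exact_mod_cast hj
      rw [hm]; linarith
    -- Pascal: `(j+1) C' = m C`
    have hpascal : ((j : ℝ) + 1) * Cj' = m * Cj := by
      have h := Nat.choose_succ_right_eq n j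
      have hcast : ((n - j : ℕ) : ℝ) = (n : ℝ) - j := Nat.cast_sub hj.le
      rw [hCj', hCj, hm, ← hcast]
      exact_mod_cast (by rw [mul_comm] at h; linarith [h] : (j + 1) * n.choose (j + 1) = (n - j) * n.choose j)
    -- per pin set: `one_step`, with `#(Λ \ P) = m`
    have hcardT : ∀ P ∈ Λ.powersetCard j, (#(Λ \ P) : ℝ) = m := by
      intro P hP
      obtain ⟨hPΛ, hPc⟩ := Finset.mem_powersetCard.1 hP
      rw [Finset.card_sdiff_of_subset hPΛ, hPc, Nat.cast_sub hj.le, hm]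
    have hsum1 : ∑ P ∈ Λ.powersetCard j, (vb P) ^ 2 / m ≤
        ∑ P ∈ Λ.powersetCard j, ∑ z ∈ Λ \ P, (vb P - vb (insert z P)) := by
      refine Finset.sum_le_sum fun P hP => ?_
      obtain ⟨hPΛ, hPc⟩ := Finset.mem_powersetCard.1 hP
      have hne : (Λ \ P).Nonempty := by
        rw [← Finset.card_pos, Finset.card_sdiff_of_subset hPΛ, hPc]; omega
      have := one_step w s Λ hK1 hK0 hE hw hw1 hs hPΛ hne hM
      rw [hcardT P hP] at this
      exact this
    -- right-hand side: `m A - (j+1) A'`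
    have hrhs : ∑ P ∈ Λ.powersetCard j, ∑ z ∈ Λ \ P, (vb P - vb (insert z P)) =
        m * A - ((j : ℝ) + 1) * A' := by
      have hin : ∀ P ∈ Λ.powersetCard j, ∑ z ∈ Λ \ P, (vb P - vb (insert z P)) =
          m * vb P - ∑ z ∈ Λ \ P, vb (insert z P) := fun P hP => by
        rw [Finset.sum_sub_distrib, Finset.sum_const, nsmul_eq_mul, hcardT P hP]
      rw [Finset.sum_congr rfl hin, Finset.sum_sub_distrib, ← Finset.mul_sum,
        sum_powersetCard_sum_sdiff_insert Λ j vb]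
    -- left-hand side: Cauchy–Schwarz over pin sets, `A² / (C m) ≤ ∑ vb² / m`
    have hlhs : A ^ 2 / (Cj * m) ≤ ∑ P ∈ Λ.powersetCard j, (vb P) ^ 2 / m := by
      have hcs := sq_sum_le_card_mul_sum_sq (s := Λ.powersetCard j) (f := vb)
      rw [Finset.card_powersetCard, ← hn] at hcs
      rw [← Finset.sum_div, div_le_div_iff₀ (mul_pos hCpos hmpos) hmpos]
      have : A ^ 2 ≤ Cj * ∑ P ∈ Λ.powersetCard j, (vb P) ^ 2 := by rw [hCj, hA]; exact hcs
      nlinarith [this, hmpos.le, Finset.sum_nonneg (fun P (_ : P ∈ Λ.powersetCard j) => sq_nonneg (vb P))]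
    have key : A ^ 2 / (Cj * m) ≤ m * A - ((j : ℝ) + 1) * A' :=
      hlhs.trans (hsum1.trans hrhs.le)
    -- translate to `v`
    have hvj : v j = A / Cj := rfl
    have hvj1 : v (j + 1) = A' / Cj' := rfl
    have hAeq : A = Cj * v j := by rw [hvj]; field_simp
    have hA'eq : ((j : ℝ) + 1) * A' = m * Cj * v (j + 1) := by
      rw [hvj1, mul_div_assoc', hpascal.symm]
      field_simp
    rw [hAeq, hA'eq] at key
    have hmc : 0 < m * Cj := mul_pos hmpos hCpos
    have key2 : m * Cj * v (j + 1) ≤ m * Cj * (v j - (v j) ^ 2 / m ^ 2) := by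
      have : m * Cj * (v j - (v j) ^ 2 / m ^ 2) = m * (Cj * v j) - (Cj * v j) ^ 2 / (Cj * m) := by
        field_simp
      rw [this]
      linarith
    exact le_of_mul_le_mul_left key2 hmc
  have := riccati_bound h0 hstepv hkn
  simpa only [hv] using this

end Spins

end Summit.CriticalPhenomena.Ising3DConformalLimit.PlantedPinningCeiling
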